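import Literature.NumberTheory.LFunctions.SemimultiplicativeMoebiusLocal
import Literature.NumberTheory.LFunctions.SemimultiplicativeMoebiusPeriodic
import Mathlib.Analysis.SpecificLimits.Basic
import HarnessLib

/-!
# Konieczny 2020, Proposition 5.4 (2) ⇒ (3): small far-window defects make `f` almost periodic

Topic `Literature/NumberTheory/LFunctions`. Everything in this file is PROVED. Let `f` be
unimodular and `q`-quasimultiplicative with gap `≤ r` (`Konieczny.IsQuasimult`), and suppose that
the window defects `δ_{K,L}(f) = 1 - ‖∑_{c<q^L} f(c q^K)‖/q^L` are uniformly small on far windows: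

  for every `κ > 0` there is `K₁` with `δ_{K,L}(f) ≤ κ` for all `K ≥ K₁` and ALL lengths `L`.

Then `f` is almost periodic (`Konieczny.IsAlmostPeriodic`, Definition 2.2), with periods that are
powers of `q`.  This is the implication (2) ⇒ (3) of Proposition 5.4 of J. Konieczny, Monatsh.
Math. 192 (2020) (arXiv:1808.06196), with the construction printed there: by Chebyshev
(Lemma 4.1) a window with small defect is `κ`-almost constant, `f(n) ≈ z_I` for `supp n ⊆ I`;
`κ`-almost every `n` has a block of `r` zero digits among the positions `[K₁, M)`, and at the first
such block `[l, l+r)` quasimultiplicativity gives `f(n) = f(n|_{[0,l)}) f(n|_{[l+r,L)}) ≈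
f(n|_{[0,l)}) z_{[l+r,L)} =: g(n)`, a `q^M`-periodic function of `n`.

* `Konieczny.isAlmostPeriodic_of_small_defects` — the statement above.
-/

noncomputable section

open Finset
open scoped ComplexConjugate

namespace Literature.NumberTheory.LFunctions

namespace Konieczny

/-! ## Three ingredients -/

/-- **Factorisation across a block of `r` zero digits** (quasimultiplicativity): if the digits
of `n` at positions `[s, s+r)` vanish then `f(n) = f((n / q^{s+r}) q^{s+r}) · f(n % q^s)`.
[cite: Konieczny2020, Definition 3.1] -/
theorem factor_across_zero_block {q r : ℕ} (hq : 2 ≤ q) {f : ℕ → ℂ} (hf : IsQuasimult q r f)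
    {n s : ℕ} (hz : n / q ^ s % q ^ r = 0) :
    f n = f (n / q ^ (s + r) * q ^ (s + r)) * f (n % q ^ s) := by
  have hqpos : 0 < q := by omega
  have hx : n / q ^ (s + r) * q ^ (s + r) = n / q ^ s * q ^ s := by
    have h2 := Nat.div_add_mod (n / q ^ s) (q ^ r)
    rw [hz, add_zero] at h2
    rw [pow_add, ← Nat.div_div_eq_div_mul, mul_comm (q ^ s) (q ^ r), ← mul_assoc, mul_comm _ (q ^ r),
      h2]
  have hn : n = n / q ^ (s + r) * q ^ (s + r) + n % q ^ s := by
    rw [hx]; exact (Nat.div_add_mod' n (q ^ s)).symm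
  conv_lhs => rw [hn]
  exact hf s _ _ (Nat.mod_lt _ (pow_pos hqpos s)) (dvd_mul_left _ _)

/-- **Chebyshev on a window** (Konieczny 2020, Lemma 4.1, for unimodular values): for a window
`(P, M)` there is a unimodular `z` with
`#{h < q^M : η < ‖f(h q^P) - z‖} · η² ≤ 2 q^M δ_{P,M}(f)` for every `η > 0`.
[cite: Konieczny2020, Lemma 4.1] -/
theorem window_chebyshev {q : ℕ} (hq : 2 ≤ q) {f : ℕ → ℂ} (hf1 : ∀ n, ‖f n‖ = 1) (P M : ℕ) :
    ∃ z : ℂ, ‖z‖ = 1 ∧ ∀ η : ℝ, 0 < η →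
      (#((range (q ^ M)).filter (fun h => η < ‖f (h * q ^ P) - z‖)) : ℝ) * η ^ 2 ≤
        2 * (q : ℝ) ^ M * (1 - ‖∑ c ∈ range (q ^ M), f (c * q ^ P)‖ / (q : ℝ) ^ M) := by
  obtain ⟨z, hz1, hz⟩ := exists_sum_norm_sub_sq_eq (range (q ^ M)) (G := fun h => f (h * q ^ P))
    (fun h _ => hf1 _)
  refine ⟨z, hz1, fun η hη => ?_⟩
  have hqM : (0 : ℝ) < (q : ℝ) ^ M := by positivity
  have hrhs : 2 * (q : ℝ) ^ M * (1 - ‖∑ c ∈ range (q ^ M), f (c * q ^ P)‖ / (q : ℝ) ^ M) =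
      ∑ h ∈ range (q ^ M), ‖f (h * q ^ P) - z‖ ^ 2 := by
    rw [hz, card_range]; push_cast; field_simp
  rw [hrhs]
  calc (#((range (q ^ M)).filter (fun h => η < ‖f (h * q ^ P) - z‖)) : ℝ) * η ^ 2
      = ∑ h ∈ (range (q ^ M)).filter (fun h => η < ‖f (h * q ^ P) - z‖), η ^ 2 := by
        rw [sum_const, nsmul_eq_mul]
    _ ≤ ∑ h ∈ (range (q ^ M)).filter (fun h => η < ‖f (h * q ^ P) - z‖), ‖f (h * q ^ P) - z‖ ^ 2 := by
        refine sum_le_sum fun h hh => ?_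
        rw [mem_filter] at hh
        exact pow_le_pow_left₀ hη.le hh.2.le 2
    _ ≤ ∑ h ∈ range (q ^ M), ‖f (h * q ^ P) - z‖ ^ 2 :=
        sum_le_sum_of_subset_of_nonneg (filter_subset _ _) fun _ _ _ => by positivity

/-- **Most digit strings contain a zero block**: the number of `n < q^L` all of whose `T` digit
blocks `[K₁ + ir, K₁ + (i+1)r)`, `i < T` (`K₁ + Tr ≤ L`), are nonzero is `q^L (1 - q^{-r})^T`.
[folklore] -/
theorem card_noZeroBlock {q : ℕ} (hq : 2 ≤ q) (r K₁ T L : ℕ) (hL : K₁ + T * r ≤ L) :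
    (#((range (q ^ L)).filter (fun n => ∀ i < T, n / q ^ (K₁ + i * r) % q ^ r ≠ 0)) : ℝ) =
      (q : ℝ) ^ L * (1 - 1 / (q : ℝ) ^ r) ^ T := by
  have hqpos : 0 < q := by omega
  have hqC : (q : ℂ) ≠ 0 := by exact_mod_cast hqpos.ne'
  set s : ℕ → ℕ := fun i => K₁ + i * r with hs
  set t : ℕ → ℕ := fun _ => r with ht
  set φ : ℕ → ℕ → ℂ := fun _ c => if c = 0 then 0 else 1 with hφ
  have hchain : ∀ i, s i + t i ≤ s (i + 1) := by intro i; simp only [hs, ht]; nlinarith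
  have htop : ∀ i < T, s i + t i ≤ L := by
    intro i hi; simp only [hs, ht]
    have : (i + 1) * r ≤ T * r := Nat.mul_le_mul_right r hi
    nlinarith
  have hind := avg_prod_blocks hq s t hchain φ T L htop
  -- the indicator of "no zero block" as the product
  have hprod : ∀ n : ℕ, (∏ i ∈ range T, φ i (n / q ^ s i % q ^ t i)) =
      if ∀ i < T, n / q ^ (K₁ + i * r) % q ^ r ≠ 0 then (1 : ℂ) else 0 := by
    intro n
    split_ifs with h
    · refine prod_eq_one fun i hi => ?_
      rw [mem_range] at hi
      simp only [hφ, hs, ht, if_neg (h i hi)]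
    · push Not at h
      obtain ⟨i, hi, hi0⟩ := h
      exact prod_eq_zero (mem_range.2 hi) (by simp only [hφ, hs, ht, hi0, if_true])
  have hcount : ∑ n ∈ range (q ^ L), ∏ i ∈ range T, φ i (n / q ^ s i % q ^ t i) =
      (#((range (q ^ L)).filter (fun n => ∀ i < T, n / q ^ (K₁ + i * r) % q ^ r ≠ 0)) : ℂ) := by
    simp_rw [hprod]
    rw [← sum_filter, sum_const, nsmul_eq_mul, mul_one]
  -- the block averages
  have hblock : ∀ i ∈ range T, ((q : ℂ) ^ t i)⁻¹ * ∑ c ∈ range (q ^ t i), φ i c =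
      (1 - 1 / (q : ℂ) ^ r) := by
    intro i _
    simp only [ht, hφ]
    have h0 : 0 ∈ range (q ^ r) := mem_range.2 (pow_pos hqpos r)
    have hsum : ∑ c ∈ range (q ^ r), (if c = 0 then (0 : ℂ) else 1) = (q : ℂ) ^ r - 1 := by
      rw [← Finset.add_sum_erase _ _ h0, if_pos rfl, zero_add]
      rw [sum_congr rfl fun c hc => if_neg (ne_of_mem_erase hc), sum_const, card_erase_of_mem h0,
        card_range, nsmul_eq_mul, mul_one]
      have : 1 ≤ q ^ r := pow_pos hqpos r
      push_cast [Nat.cast_sub this]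
      ring
    rw [hsum]
    field_simp
  rw [hcount, prod_congr rfl hblock, prod_const, card_range] at hind
  have hreal : ((#((range (q ^ L)).filter (fun n => ∀ i < T, n / q ^ (K₁ + i * r) % q ^ r ≠ 0)) : ℝ) : ℂ) =
      (((q : ℝ) ^ L * (1 - 1 / (q : ℝ) ^ r) ^ T : ℝ) : ℂ) := by
    push_cast
    rw [← hind, ← mul_assoc, mul_inv_cancel₀ (pow_ne_zero L hqC), one_mul]
  exact_mod_cast hreal

/-! ## Proposition 5.4 (2) ⇒ (3) -/

/-- **Konieczny 2020, Proposition 5.4, (2) ⇒ (3).**  Let `f` be unimodular and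
`q`-quasimultiplicative with gap `≤ r`, and assume that for every `κ > 0` there is `K₁` such that
`δ_{K,L}(f) = 1 - ‖∑_{c<q^L} f(c q^K)‖/q^L ≤ κ` for all `K ≥ K₁` and all `L`.  Then `f` is almost
periodic in the sense of Definition 2.2 (indeed `q`-almost periodic: the periods are powers of
`q`). [cite: Konieczny2020, Proposition 5.4] -/
theorem isAlmostPeriodic_of_small_defects {q r : ℕ} (hq : 2 ≤ q) {f : ℕ → ℂ}
    (hf : IsQuasimult q r f) (hf1 : ∀ n, ‖f n‖ = 1)
    (hsmall : ∀ κ : ℝ, 0 < κ → ∃ K₁ : ℕ, ∀ K L : ℕ, K₁ ≤ K →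
      1 - ‖∑ c ∈ range (q ^ L), f (c * q ^ K)‖ / (q : ℝ) ^ L ≤ κ) :
    IsAlmostPeriodic f := by
  classical
  have hqpos : 0 < q := by omega
  have hq1 : 1 < q := by omega
  have hq0 : (0 : ℝ) < q := by exact_mod_cast hqpos
  have hf1' : ∀ n, ‖f n‖ ≤ 1 := fun n => (hf1 n).le
  intro ε hε
  -- parameters: `ε₀ = ε/q`, `T` with `(1 - q^{-r})^T ≤ ε₀/2`, `κ = ε₀³/(4T+4)`, `K₁`, `M = K₁ + Tr`
  set ε₀ : ℝ := ε / q with hε₀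
  have hε₀pos : 0 < ε₀ := by positivity
  have hε₀ε : ε₀ ≤ ε := by
    rw [hε₀, div_le_iff₀ hq0]
    have : (1 : ℝ) ≤ q := by exact_mod_cast hqpos
    nlinarith
  have hρ1 : 1 - 1 / (q : ℝ) ^ r < 1 := by
    have : 0 < 1 / (q : ℝ) ^ r := by positivity
    linarith
  have hρ0 : 0 ≤ 1 - 1 / (q : ℝ) ^ r := by
    rw [sub_nonneg, div_le_one (by positivity)]
    exact one_le_pow₀ (by exact_mod_cast hqpos)
  obtain ⟨T, hT⟩ := exists_pow_lt_of_lt_one (show 0 < ε₀ / 2 by positivity) hρ1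
  set κ : ℝ := ε₀ ^ 3 / (4 * T + 4) with hκ
  have hκ0 : 0 < κ := by positivity
  obtain ⟨K₁, hK₁⟩ := hsmall κ hκ0
  set M : ℕ := K₁ + T * r with hM
  set Qp : ℕ := q ^ M with hQp
  have hQpos : 0 < Qp := pow_pos hqpos M
  -- Chebyshev constants for all windows
  have hcheb := fun P L => window_chebyshev hq hf1 P L
  choose z hz1 hz using hcheb
  -- the first zero block of `a` among the `T` candidate blocks (or `T` if none)
  set zb : ℕ → ℕ → Prop := fun i a => a / q ^ (K₁ + i * r) % q ^ r = 0 with hzb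
  set FZ : ℕ → ℕ := fun a => if h : ∃ i, i < T ∧ zb i a then Nat.find h else T with hFZ
  have hFZ_spec : ∀ a, FZ a < T → zb (FZ a) a := by
    intro a ha
    simp only [hFZ] at ha ⊢
    split_ifs with h
    · exact (Nat.find_spec h).2
    · rw [dif_neg h] at ha; exact absurd ha (lt_irrefl _)
  have hFZ_le : ∀ a, FZ a ≤ T := by
    intro a; simp only [hFZ]; split_ifs with h
    · exact (Nat.find_spec h).1.le
    · exact le_rfl
  have hFZ_none : ∀ a, FZ a = T → ∀ i < T, ¬ zb i a := by
    intro a ha i hi hzi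
    simp only [hFZ] at ha
    split_ifs at ha with h
    · have := (Nat.find_spec h).1; omega
    · exact h ⟨i, hi, hzi⟩
  refine ⟨Qp, hQpos, fun N => ?_⟩
  -- small `N`: take `g = f ∘ (% Qp)`
  by_cases hN : N ≤ Qp
  · refine ⟨fun n => f (n % Qp), fun n => by simp [Nat.add_mod_right], fun n => hf1' _, ?_⟩
    have : (range N).filter (fun n => ε < ‖f n - f (n % Qp)‖) = ∅ := by
      refine filter_eq_empty_iff.2 fun n hn h => ?_
      rw [mem_range] at hn
      rw [Nat.mod_eq_of_lt (lt_of_lt_of_le hn hN), sub_self, norm_zero] at h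
      exact absurd h (not_lt.2 hε.le)
    rw [this, card_empty]; push_cast; positivity
  -- large `N`: the scale `L` with `Qp < q^L`, `N < q^L ≤ q N`
  push Not at hN
  set L : ℕ := Nat.log q N + 1 with hL
  have hNL : N < q ^ L := Nat.lt_pow_succ_log_self hq1 N
  have hN0 : N ≠ 0 := by omega
  have hLN : (q : ℝ) ^ L ≤ q * N := by
    have h1 : q ^ Nat.log q N ≤ N := Nat.pow_log_le_self q hN0
    have : (q : ℝ) ^ L = q * (q : ℝ) ^ Nat.log q N := by rw [hL, pow_succ]; ring
    rw [this]
    exact mul_le_mul_of_nonneg_left (by exact_mod_cast h1) hq0.le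
  have hML : M ≤ L := by
    have : M ≤ Nat.log q N := Nat.le_log_of_pow_le hq1 hN.le
    omega
  -- the approximant
  set G : ℕ → ℂ := fun n =>
    if FZ (n % Qp) < T then f (n % Qp % q ^ (K₁ + FZ (n % Qp) * r)) * z (K₁ + (FZ (n % Qp) + 1) * r)
      (L - (K₁ + (FZ (n % Qp) + 1) * r)) else 0 with hG
  refine ⟨G, fun n => by simp only [hG, Nat.add_mod_right], fun n => ?_, ?_⟩
  · simp only [hG]
    split_ifs
    · rw [norm_mul, hf1, hz1, mul_one]
    · simp
  -- the bad set is contained in `NoZero ∪ ⋃_i B_i`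
  set NoZero := (range (q ^ L)).filter (fun n => ∀ i < T, n / q ^ (K₁ + i * r) % q ^ r ≠ 0)
    with hNoZero
  set B : ℕ → Finset ℕ := fun i => (range (q ^ L)).filter (fun n =>
    ε₀ < ‖f (n / q ^ (K₁ + (i + 1) * r) * q ^ (K₁ + (i + 1) * r)) -
      z (K₁ + (i + 1) * r) (L - (K₁ + (i + 1) * r))‖) with hB
  have hzb_mod : ∀ n i, i < T → (zb i (n % Qp) ↔ zb i n) := by
    intro n i hi
    simp only [hzb]
    have hn : n = n / Qp * q ^ M + n % Qp := by rw [hQp]; exact (Nat.div_add_mod' n (q ^ M)).symm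
    conv_rhs => rw [hn]
    rw [block_low hqpos]
    simp only [hM]
    have : (i + 1) * r ≤ T * r := Nat.mul_le_mul_right r hi
    nlinarith
  have hsub : (range N).filter (fun n => ε < ‖f n - G n‖) ⊆ NoZero ∪ (range T).biUnion B := by
    intro n hn
    rw [mem_filter, mem_range] at hn
    obtain ⟨hnN, hbad⟩ := hn
    have hnL : n < q ^ L := hnN.trans hNL
    rw [mem_union, mem_biUnion]
    by_cases hi : FZ (n % Qp) < T
    · right
      set i := FZ (n % Qp) with hidef
      refine ⟨i, mem_range.2 hi, ?_⟩
      simp only [hB, mem_filter, mem_range]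
      refine ⟨hnL, ?_⟩
      have hzbi : zb i n := (hzb_mod n i hi).1 (hFZ_spec _ hi)
      simp only [hzb] at hzbi
      have hfac := factor_across_zero_block hq hf hzbi
      have hGn : G n = f (n % q ^ (K₁ + i * r)) * z (K₁ + (i + 1) * r) (L - (K₁ + (i + 1) * r)) := by
        simp only [hG]
        rw [if_pos hi, ← hidef, hQp, Nat.mod_mod_of_dvd _ (pow_dvd_pow q (by
          simp only [hM]; have := Nat.mul_le_mul_right r hi.le; nlinarith))]
      rw [hGn, hfac, show K₁ + i * r + r = K₁ + (i + 1) * r by ring] at hbad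
      rw [mul_comm (f _) (f (n % q ^ (K₁ + i * r))), ← mul_sub, norm_mul, hf1, one_mul] at hbad
      exact lt_of_le_of_lt hε₀ε hbad
    · left
      have hT' : FZ (n % Qp) = T := le_antisymm (hFZ_le _) (not_lt.1 hi)
      simp only [hNoZero, mem_filter, mem_range]
      refine ⟨hnL, fun j hj => ?_⟩
      have := hFZ_none _ hT' j hj
      rwa [hzb_mod n j hj] at this
  -- counting
  have hcard_NoZero : (#NoZero : ℝ) ≤ ε₀ / 2 * (q : ℝ) ^ L := by
    rw [hNoZero, card_noZeroBlock hq r K₁ T L hML, mul_comm]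
    exact mul_le_mul_of_nonneg_right hT.le (by positivity)
  have hcard_B : ∀ i ∈ range T, (#(B i) : ℝ) ≤ 2 * κ / ε₀ ^ 2 * (q : ℝ) ^ L := by
    intro i hi
    rw [mem_range] at hi
    set P := K₁ + (i + 1) * r with hP
    have hPL : P ≤ L := by
      simp only [hP]
      have : (i + 1) * r ≤ T * r := Nat.mul_le_mul_right r hi
      have : K₁ + T * r ≤ L := hML
      omega
    obtain ⟨L', hL'⟩ : ∃ L', L = P + L' := ⟨L - P, by omega⟩
    -- split `n = h q^P + a`
    have hsplit : #(B i) = q ^ P * #((range (q ^ L')).filter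
        (fun h => ε₀ < ‖f (h * q ^ P) - z P L'‖)) := by
      simp only [hB, ← hP, hL', Nat.add_sub_cancel_left]
      rw [card_eq_sum_ones, sum_filter, sum_range_pow_add, card_eq_sum_ones, sum_filter, mul_sum]
      refine sum_congr rfl fun h _ => ?_
      rw [sum_congr rfl fun a ha => by rw [block_high hqpos (mem_range.1 ha)], sum_const, card_range,
        smul_eq_mul]
    have hcheb := hz P L' ε₀ hε₀pos
    have hδ : 1 - ‖∑ c ∈ range (q ^ L'), f (c * q ^ P)‖ / (q : ℝ) ^ L' ≤ κ :=
      hK₁ P L' (by simp only [hP]; omega)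
    have hqL' : (0 : ℝ) ≤ (q : ℝ) ^ L' := by positivity
    have hcnt : (#((range (q ^ L')).filter (fun h => ε₀ < ‖f (h * q ^ P) - z P L'‖)) : ℝ) ≤
        2 * κ / ε₀ ^ 2 * (q : ℝ) ^ L' := by
      rw [div_mul_eq_mul_div, le_div_iff₀ (by positivity)]
      nlinarith
    calc (#(B i) : ℝ) = (q : ℝ) ^ P *
          (#((range (q ^ L')).filter (fun h => ε₀ < ‖f (h * q ^ P) - z P L'‖)) : ℝ) := by
          rw [hsplit]; push_cast; ring
      _ ≤ (q : ℝ) ^ P * (2 * κ / ε₀ ^ 2 * (q : ℝ) ^ L') :=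
          mul_le_mul_of_nonneg_left hcnt (by positivity)
      _ = 2 * κ / ε₀ ^ 2 * (q : ℝ) ^ L := by rw [hL', pow_add (q : ℝ) P L']; ring
  calc ((#((range N).filter (fun n => ε < ‖f n - G n‖)) : ℕ) : ℝ)
      ≤ (#(NoZero ∪ (range T).biUnion B) : ℝ) := by exact_mod_cast card_le_card hsub
    _ ≤ (#NoZero : ℝ) + ∑ i ∈ range T, (#(B i) : ℝ) := by
        have h1 := card_union_le NoZero ((range T).biUnion B)
        have h2 := card_biUnion_le (s := range T) (t := B)
        calc (#(NoZero ∪ (range T).biUnion B) : ℝ) ≤ #NoZero + #((range T).biUnion B) := by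
              exact_mod_cast h1
          _ ≤ _ := by gcongr; exact_mod_cast h2
    _ ≤ ε₀ / 2 * (q : ℝ) ^ L + ∑ i ∈ range T, 2 * κ / ε₀ ^ 2 * (q : ℝ) ^ L :=
        add_le_add hcard_NoZero (sum_le_sum hcard_B)
    _ = ε₀ / 2 * (q : ℝ) ^ L + T * (2 * κ / ε₀ ^ 2) * (q : ℝ) ^ L := by
        rw [sum_const, card_range, nsmul_eq_mul]; ring
    _ ≤ ε₀ / 2 * (q : ℝ) ^ L + ε₀ / 2 * (q : ℝ) ^ L := by
        gcongr
        rw [hκ]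
        have hT0 : (0 : ℝ) ≤ T := Nat.cast_nonneg T
        rw [show (T : ℝ) * (2 * (ε₀ ^ 3 / (4 * T + 4)) / ε₀ ^ 2) = ε₀ * (T / (2 * T + 2)) by
          field_simp; ring]
        have : (T : ℝ) / (2 * T + 2) ≤ 1 / 2 := by
          rw [div_le_div_iff₀ (by positivity) (by positivity)]; nlinarith
        nlinarith
    _ = ε₀ * (q : ℝ) ^ L := by ring
    _ ≤ ε₀ * (q * N) := mul_le_mul_of_nonneg_left hLN hε₀pos.le
    _ = ε * N := by rw [hε₀]; field_simp

end Konieczny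

end Literature.NumberTheory.LFunctions
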